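import Literature.MathematicalPhysics.QuantumLattice.SectorisedKernelNormRefinementPrescribed
import HarnessLib

/-!
# Re-sectorisation with prescribed legs, WEIGHTED: a position weight on the fine tuples dominated by a coarse weight times leg factors

Topic `MathematicalPhysics/QuantumLattice`; the weighted twin of `SectorisedKernelNormRefinementPrescribed.prescribedLegSum_refine_le_split` (same
label currency `P × S`, same leg-wise transform `W″_{σ″}(x″) = Σ_{σ′,x′} ∏_i T((x″_i,σ″_i),(x′_i,σ′_i)) W_{σ′}(x′)` vanishing off a child relation).
Benfatto–Giuliani–Mastropietro 2006 §2.8 (2.77), (2.82)–(2.84), (2.88)–(2.90): the multiscale norms carry a tree-decay WEIGHT on the positions of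
the legs; when a kernel of scale `h′` is re-sectorised at a lower scale the weight of the fine positions is dominated by the weight of the coarse
positions times one displacement factor per leg (`w(x″) ≤ w(x′)·∏_i ω(x″_i, x′_i)`, e.g. `1 + γ^h d(x″) ≤ (1 + γ^h d(x′))·∏_i (1 + γ^h|x″_i − x′_i|)`),
and each leg then pays the ω-WEIGHTED `L¹` size of the overlap kernel instead of the plain one.

* **`prescribedLegSumWt_refine_le_split`** — with weights `wf ≥ 0` (fine), `wc ≥ 0` (coarse), leg factors `ω ≥ 0`, domination
  `wf x″ ≤ wc x′ · ∏_i ω(x″_i, x′_i)`, weighted per-pair position sums `Σ_{x″} ‖T((x″,s″),(x′,s′))‖·ω(x″,x′) ≤ c₁`,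
  `Σ_{x′} ‖T((x″,s″),(x′,s′))‖·ω(x″,x′) ≤ c₁r`, parents `≤ ρ`, refinement counts at fixed prescription `R₁` / `R₂` off / on a class `B`, and bounds
  `N₁` / `N₂` on the WEIGHTED coarse prescribed sums `ε^m Σ_{σ′|_E = τ′|_E} Σ_{x′_p = y} wc(x′)‖W_{σ′}(x′)‖`:
  `ε^m Σ_{σ″ ∈ A″, σ″|_E = τ″|_E} Σ_{x″_p = x} wf(x″)‖W″_{σ″}(x″)‖ ≤ c₁^m · c₁r · ρ^{|E|} · (R₁N₁ + R₂N₂)`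
  (`wf = wc = 1`, `ω = 1` is the unweighted theorem).

Cell gate-hubbard-kl, K3 engine child clause (E1): the WEIGHTED levels track of the blocked birth-level tower (weighted G1-L suppliers
`GrassmannWeighted…Prescribed`, tree weight `klScaleWt`).  Everything is proved; no definition, no named fact.

## Sources

G. Benfatto, A. Giuliani, V. Mastropietro, Ann. Henri Poincaré 7 (2006) 809–898, §2.8 (2.77), (2.82)–(2.84), (2.88)–(2.90), App. A3 Lemma A3.1
[`BenfattoGiulianiMastropietro2006`].
-/

noncomputable section

namespace Literature.MathematicalPhysics.QuantumLattice

open Finset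

variable {𝕜 : Type*} [RCLike 𝕜] {S S'' P P'' : Type*} [Fintype S] [DecidableEq S] [DecidableEq S''] [Fintype P] [DecidableEq P]
  [Fintype P''] [DecidableEq P'']

/-- **Weighted prescribed-legs sector sums under a child-supported leg-wise transform, split by a class of coarse tuples** (BGM 2006
§2.8 (2.77), (2.82)–(2.84), (2.88)–(2.90), App. A3 Lemma A3.1): as `prescribedLegSum_refine_le_split`, with a fine position weight `wf` dominated by a
coarse weight `wc` times leg factors `ω` (`wf x″ ≤ wc x′ · ∏_i ω(x″_i,x′_i)`), ω-weighted per-pair position sums of the transform (`≤ c₁` fine summed,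
`≤ c₁r` coarse summed), and `N₁`/`N₂` bounding the `wc`-weighted coarse prescribed sums:
`ε^m Σ_{σ″ ∈ A″, σ″|_E = τ″|_E} Σ_{x″ : x″_p = x} wf(x″) ‖W″_{σ″}(x″)‖ ≤ c₁^m · c₁r · ρ^{|E|} · (R₁ · N₁ + R₂ · N₂)`.
[cite: BenfattoGiulianiMastropietro2006, §2.8 (2.77), (2.82)-(2.84) and (2.88)-(2.90), App. A3 Lemma A3.1] -/
theorem prescribedLegSumWt_refine_le_split {ε : ℝ} (hε : 0 ≤ ε) {m : ℕ} (T : P'' × S'' → P × S → 𝕜) (child : S'' → S → Prop)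
    [DecidableRel child] (hT0 : ∀ x'' s'' x' s', ¬ child s'' s' → T (x'', s'') (x', s') = 0)
    {c₁ c₁r ρc R₁ R₂ N₁ N₂ : ℝ} (hc₁ : 0 ≤ c₁) (hc₁r : 0 ≤ c₁r) (hR₁ : 0 ≤ R₁) (hR₂ : 0 ≤ R₂) (hN₁0 : 0 ≤ N₁) (hN₂0 : 0 ≤ N₂)
    (ω : P'' → P → ℝ) (hω0 : ∀ x'' x', 0 ≤ ω x'' x')
    (h1 : ∀ (s'' : S'') (x' : P) (s' : S), ∑ x'' : P'', ‖T (x'', s'') (x', s')‖ * ω x'' x' ≤ c₁)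
    (h1r : ∀ (x'' : P'') (s'' : S'') (s' : S), ∑ x' : P, ‖T (x'', s'') (x', s')‖ * ω x'' x' ≤ c₁r)
    (hρ : ∀ s'' : S'', (((univ.filter fun s' : S => child s'' s').card : ℝ)) ≤ ρc)
    (A'' : Finset (Fin (m + 1) → S'')) (B : Finset (Fin (m + 1) → S))
    (E : Finset (Fin (m + 1))) (τ'' : Fin (m + 1) → S'') (p : Fin (m + 1)) (hp : p ∈ E)
    (hRoff : ∀ σ' : Fin (m + 1) → S, σ' ∉ B →
      (((A''.filter fun σ'' => (∀ e ∈ E, σ'' e = τ'' e) ∧ ∀ i, child (σ'' i) (σ' i)).card : ℝ)) ≤ R₁)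
    (hRon : ∀ σ' : Fin (m + 1) → S, σ' ∈ B →
      (((A''.filter fun σ'' => (∀ e ∈ E, σ'' e = τ'' e) ∧ ∀ i, child (σ'' i) (σ' i)).card : ℝ)) ≤ R₂)
    (W : (Fin (m + 1) → S) → (Fin (m + 1) → P) → 𝕜)
    (wf : (Fin (m + 1) → P'') → ℝ) (wc : (Fin (m + 1) → P) → ℝ) (hwf0 : ∀ x'', 0 ≤ wf x'') (hwc0 : ∀ x', 0 ≤ wc x')
    (hw : ∀ (x'' : Fin (m + 1) → P'') (x' : Fin (m + 1) → P), wf x'' ≤ wc x' * ∏ i, ω (x'' i) (x' i))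
    (hN₁ : ∀ (τ' : Fin (m + 1) → S) (y : P),
      ε ^ m * ∑ σ' ∈ univ.filter (fun σ' : Fin (m + 1) → S => ∀ e ∈ E, σ' e = τ' e),
        ∑ x' ∈ univ.filter (fun x' : Fin (m + 1) → P => x' p = y), (wc x' * ‖W σ' x'‖) ≤ N₁)
    (hN₂ : ∀ (τ' : Fin (m + 1) → S) (y : P),
      ε ^ m * ∑ σ' ∈ B.filter (fun σ' : Fin (m + 1) → S => ∀ e ∈ E, σ' e = τ' e),
        ∑ x' ∈ univ.filter (fun x' : Fin (m + 1) → P => x' p = y), (wc x' * ‖W σ' x'‖) ≤ N₂)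
    (x : P'') :
    ε ^ m * ∑ σ'' ∈ A''.filter (fun σ'' => ∀ e ∈ E, σ'' e = τ'' e),
        ∑ x'' ∈ univ.filter (fun x'' : Fin (m + 1) → P'' => x'' p = x),
          wf x'' * ‖∑ σ' : Fin (m + 1) → S, ∑ x' : Fin (m + 1) → P, (∏ i, T (x'' i, σ'' i) (x' i, σ' i)) * W σ' x'‖ ≤
      c₁ ^ m * c₁r * ρc ^ E.card * (R₁ * N₁ + R₂ * N₂) := by
  have hρc : 0 ≤ ρc := le_trans (Nat.cast_nonneg _) (hρ (τ'' p))
  -- abbreviations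
  set a : Fin (m + 1) → P'' → S'' → P → S → ℝ := fun _ x'' s'' x' s' => ‖T (x'', s'') (x', s')‖ * ω x'' x' with ha
  have ha0 : ∀ i x'' s'' x' s', 0 ≤ a i x'' s'' x' s' := fun _ x'' _ x' _ => mul_nonneg (norm_nonneg _) (hω0 x'' x')
  set AE := A''.filter (fun σ'' => ∀ e ∈ E, σ'' e = τ'' e) with hAE
  set Xp := univ.filter (fun x'' : Fin (m + 1) → P'' => x'' p = x) with hXp
  -- the compatibility of a coarse tuple with the prescription
  let compat : (Fin (m + 1) → S) → Prop := fun σ' => ∀ e ∈ E, child (τ'' e) (σ' e)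
  -- the pinned sizes of the coarse family
  set f : (Fin (m + 1) → S) → P → ℝ := fun σ' y =>
    ε ^ m * ∑ x' ∈ univ.filter (fun x' : Fin (m + 1) → P => x' p = y), (wc x' * ‖W σ' x'‖) with hf
  have hf0 : ∀ σ' y, 0 ≤ f σ' y :=
    fun σ' y => mul_nonneg (pow_nonneg hε _) (sum_nonneg fun x' _ => mul_nonneg (hwc0 x') (norm_nonneg _))
  -- Step 1: triangle inequality and reordering of the sums
  have step1 : ε ^ m * ∑ σ'' ∈ AE, ∑ x'' ∈ Xp,
        wf x'' * ‖∑ σ' : Fin (m + 1) → S, ∑ x' : Fin (m + 1) → P, (∏ i, T (x'' i, σ'' i) (x' i, σ' i)) * W σ' x'‖ ≤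
      ∑ σ' : Fin (m + 1) → S, ∑ x' : Fin (m + 1) → P, (wc x' * ‖W σ' x'‖) *
        (ε ^ m * ∑ σ'' ∈ AE, ∑ x'' ∈ Xp, ∏ i, a i (x'' i) (σ'' i) (x' i) (σ' i)) := by
    calc ε ^ m * ∑ σ'' ∈ AE, ∑ x'' ∈ Xp,
          wf x'' * ‖∑ σ' : Fin (m + 1) → S, ∑ x' : Fin (m + 1) → P, (∏ i, T (x'' i, σ'' i) (x' i, σ' i)) * W σ' x'‖
        ≤ ε ^ m * ∑ σ'' ∈ AE, ∑ x'' ∈ Xp, ∑ σ' : Fin (m + 1) → S, ∑ x' : Fin (m + 1) → P,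
            (∏ i, a i (x'' i) (σ'' i) (x' i) (σ' i)) * (wc x' * ‖W σ' x'‖) := by
          refine mul_le_mul_of_nonneg_left (sum_le_sum fun σ'' _ => sum_le_sum fun x'' _ => ?_) (pow_nonneg hε _)
          -- `wf x'' ‖Σ Σ (∏T) W‖ ≤ Σ Σ wf x'' (∏|T|) ‖W‖ ≤ Σ Σ (∏ |T| ω) wc x' ‖W‖`
          calc wf x'' * ‖∑ σ' : Fin (m + 1) → S, ∑ x' : Fin (m + 1) → P, (∏ i, T (x'' i, σ'' i) (x' i, σ' i)) * W σ' x'‖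
              ≤ wf x'' * ∑ σ' : Fin (m + 1) → S, ∑ x' : Fin (m + 1) → P, (∏ i, ‖T (x'' i, σ'' i) (x' i, σ' i)‖) * ‖W σ' x'‖ := by
                refine mul_le_mul_of_nonneg_left ?_ (hwf0 x'')
                refine (norm_sum_le _ _).trans (sum_le_sum fun σ' _ => (norm_sum_le _ _).trans (sum_le_sum fun x' _ => ?_))
                rw [norm_mul, norm_prod]
            _ = ∑ σ' : Fin (m + 1) → S, ∑ x' : Fin (m + 1) → P, wf x'' * ((∏ i, ‖T (x'' i, σ'' i) (x' i, σ' i)‖) * ‖W σ' x'‖) := by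
                rw [mul_sum]
                exact sum_congr rfl fun σ' _ => by rw [mul_sum]
            _ ≤ ∑ σ' : Fin (m + 1) → S, ∑ x' : Fin (m + 1) → P,
                  (∏ i, a i (x'' i) (σ'' i) (x' i) (σ' i)) * (wc x' * ‖W σ' x'‖) := by
                refine sum_le_sum fun σ' _ => sum_le_sum fun x' _ => ?_
                have hP : 0 ≤ (∏ i, ‖T (x'' i, σ'' i) (x' i, σ' i)‖) * ‖W σ' x'‖ :=
                  mul_nonneg (prod_nonneg fun i _ => norm_nonneg _) (norm_nonneg _)
                calc wf x'' * ((∏ i, ‖T (x'' i, σ'' i) (x' i, σ' i)‖) * ‖W σ' x'‖)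
                    ≤ (wc x' * ∏ i, ω (x'' i) (x' i)) * ((∏ i, ‖T (x'' i, σ'' i) (x' i, σ' i)‖) * ‖W σ' x'‖) :=
                      mul_le_mul_of_nonneg_right (hw x'' x') hP
                  _ = (∏ i, a i (x'' i) (σ'' i) (x' i) (σ' i)) * (wc x' * ‖W σ' x'‖) := by
                      simp only [ha]
                      rw [prod_mul_distrib]
                      ring
      _ = _ := by
          rw [mul_sum]
          calc ∑ σ'' ∈ AE, ε ^ m * ∑ x'' ∈ Xp, ∑ σ' : Fin (m + 1) → S, ∑ x' : Fin (m + 1) → P,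
                (∏ i, a i (x'' i) (σ'' i) (x' i) (σ' i)) * (wc x' * ‖W σ' x'‖)
              = ∑ σ'' ∈ AE, ∑ x'' ∈ Xp, ∑ σ' : Fin (m + 1) → S, ∑ x' : Fin (m + 1) → P,
                  ε ^ m * ((∏ i, a i (x'' i) (σ'' i) (x' i) (σ' i)) * (wc x' * ‖W σ' x'‖)) := by
                simp only [mul_sum]
            _ = ∑ σ'' ∈ AE, ∑ σ' : Fin (m + 1) → S, ∑ x'' ∈ Xp, ∑ x' : Fin (m + 1) → P,
                  ε ^ m * ((∏ i, a i (x'' i) (σ'' i) (x' i) (σ' i)) * (wc x' * ‖W σ' x'‖)) :=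
                sum_congr rfl fun σ'' _ => Finset.sum_comm
            _ = ∑ σ' : Fin (m + 1) → S, ∑ σ'' ∈ AE, ∑ x'' ∈ Xp, ∑ x' : Fin (m + 1) → P,
                  ε ^ m * ((∏ i, a i (x'' i) (σ'' i) (x' i) (σ' i)) * (wc x' * ‖W σ' x'‖)) := Finset.sum_comm
            _ = ∑ σ' : Fin (m + 1) → S, ∑ σ'' ∈ AE, ∑ x' : Fin (m + 1) → P, ∑ x'' ∈ Xp,
                  ε ^ m * ((∏ i, a i (x'' i) (σ'' i) (x' i) (σ' i)) * (wc x' * ‖W σ' x'‖)) :=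
                sum_congr rfl fun σ' _ => sum_congr rfl fun σ'' _ => Finset.sum_comm
            _ = ∑ σ' : Fin (m + 1) → S, ∑ x' : Fin (m + 1) → P, ∑ σ'' ∈ AE, ∑ x'' ∈ Xp,
                  ε ^ m * ((∏ i, a i (x'' i) (σ'' i) (x' i) (σ' i)) * (wc x' * ‖W σ' x'‖)) :=
                sum_congr rfl fun σ' _ => Finset.sum_comm
            _ = _ := by
                refine sum_congr rfl fun σ' _ => sum_congr rfl fun x' _ => ?_
                rw [mul_sum, mul_sum]
                refine sum_congr rfl fun σ'' _ => ?_
                rw [mul_sum, mul_sum]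
                exact sum_congr rfl fun x'' _ => by ring
  -- Step 2: the position sums factorise leg by leg; the pinned leg keeps its entry, the others cost `c₁` (or `0` off the children)
  have step2 : ∀ (σ'' : Fin (m + 1) → S'') (σ' : Fin (m + 1) → S) (x' : Fin (m + 1) → P), σ'' p = τ'' p →
      ∑ x'' ∈ Xp, ∏ i, a i (x'' i) (σ'' i) (x' i) (σ' i) ≤
        a p x (τ'' p) (x' p) (σ' p) * (if ∀ i, child (σ'' i) (σ' i) then c₁ ^ m else 0) := by
    intro σ'' σ' x' hσp
    set t : Fin (m + 1) → Finset P'' := fun i => if i = p then {x} else univ with ht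
    have hset : Xp = Fintype.piFinset t := by
      ext x''
      simp only [hXp, mem_filter, mem_univ, true_and, Fintype.mem_piFinset, ht]
      refine ⟨fun h i => ?_, fun h => by simpa using h p⟩
      split_ifs with hi
      · subst hi; simp [h]
      · exact mem_univ _
    have hfac : ∑ x'' ∈ Xp, ∏ i, a i (x'' i) (σ'' i) (x' i) (σ' i) =
        a p x (σ'' p) (x' p) (σ' p) * ∏ i ∈ univ.erase p, ∑ j ∈ t i, a i j (σ'' i) (x' i) (σ' i) := by
      rw [hset, ← prod_univ_sum t (fun i j => a i j (σ'' i) (x' i) (σ' i)),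
        ← Finset.mul_prod_erase univ (fun i => ∑ j ∈ t i, a i j (σ'' i) (x' i) (σ' i)) (mem_univ p)]
      congr 1
      simp only [ht, if_true, sum_singleton]
    rw [hfac, hσp]
    split_ifs with hch
    · refine mul_le_mul_of_nonneg_left ?_ (ha0 p x (τ'' p) (x' p) (σ' p))
      have hcard : (univ.erase p).card = m := by rw [card_erase_of_mem (mem_univ p), card_univ, Fintype.card_fin]; omega
      calc ∏ i ∈ univ.erase p, ∑ j ∈ t i, a i j (σ'' i) (x' i) (σ' i) ≤ ∏ i ∈ univ.erase p, c₁ := by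
            refine prod_le_prod (fun i _ => sum_nonneg fun j _ => ha0 i j _ _ _) fun i hi => ?_
            have hip : i ≠ p := ne_of_mem_erase hi
            simp only [ht, if_neg hip]
            exact h1 _ _ _
        _ = c₁ ^ m := by rw [prod_const, hcard]
    · rw [mul_zero]
      push Not at hch
      obtain ⟨i, hi⟩ := hch
      by_cases hip : i = p
      · subst hip
        have hz : a i x (τ'' i) (x' i) (σ' i) = 0 := by simp only [ha]; rw [hT0 _ _ _ _ (hσp ▸ hi), norm_zero, zero_mul]
        rw [hz, zero_mul]
      · refine le_of_eq ?_
        rw [prod_eq_zero (mem_erase.2 ⟨hip, mem_univ i⟩) ?_, mul_zero]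
        simp only [ht, if_neg hip]
        exact sum_eq_zero fun j _ => by simp only [ha]; rw [hT0 _ _ _ _ hi, norm_zero, zero_mul]
  -- Step 3: the sector sum over the admissible fine tuples costs the refinement count at fixed prescription, `R₁` off the class and
  -- `R₂` on it, and VANISHES unless the coarse tuple is compatible with the prescription
  have step3 : ∀ (σ' : Fin (m + 1) → S) (x' : Fin (m + 1) → P),
      ∑ σ'' ∈ AE, ∑ x'' ∈ Xp, ∏ i, a i (x'' i) (σ'' i) (x' i) (σ' i) ≤
        a p x (τ'' p) (x' p) (σ' p) *
          (c₁ ^ m * (if compat σ' then (if σ' ∈ B then R₂ else R₁) else 0)) := by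
    intro σ' x'
    have hRσ : (((A''.filter fun σ'' => (∀ e ∈ E, σ'' e = τ'' e) ∧ ∀ i, child (σ'' i) (σ' i)).card : ℝ)) ≤
        (if compat σ' then (if σ' ∈ B then R₂ else R₁) else 0) := by
      split_ifs with hc hB
      · exact hRon σ' hB
      · exact hRoff σ' hB
      · -- incompatible coarse tuple: no admissible fine tuple refines it
        have hem : (A''.filter fun σ'' => (∀ e ∈ E, σ'' e = τ'' e) ∧ ∀ i, child (σ'' i) (σ' i)) = ∅ := by
          rw [Finset.filter_eq_empty_iff]
          intro σ'' _ hσ''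
          exact hc fun e he => by rw [← hσ''.1 e he]; exact hσ''.2 e
        rw [hem, card_empty, Nat.cast_zero]
    calc ∑ σ'' ∈ AE, ∑ x'' ∈ Xp, ∏ i, a i (x'' i) (σ'' i) (x' i) (σ' i)
        ≤ ∑ σ'' ∈ AE, a p x (τ'' p) (x' p) (σ' p) * (if ∀ i, child (σ'' i) (σ' i) then c₁ ^ m else 0) :=
          sum_le_sum fun σ'' hσ'' => step2 σ'' σ' x' ((mem_filter.1 hσ'').2 p hp)
      _ = a p x (τ'' p) (x' p) (σ' p) * (c₁ ^ m *
            (((A''.filter fun σ'' => (∀ e ∈ E, σ'' e = τ'' e) ∧ ∀ i, child (σ'' i) (σ' i)).card : ℝ))) := by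
          rw [← mul_sum, ← sum_filter, hAE, filter_filter, sum_const, nsmul_eq_mul]
          ring
      _ ≤ _ := mul_le_mul_of_nonneg_left (mul_le_mul_of_nonneg_left hRσ (pow_nonneg hc₁ _)) (ha0 p x _ (x' p) (σ' p))
  -- Step 4: the coarse sums restricted to compatible tuples, fibrewise over the pinned leg and grouped by the restriction to `E`
  have step4 : ∀ Bs : Finset (Fin (m + 1) → S), ∀ N : ℝ, 0 ≤ N →
      (∀ (τ' : Fin (m + 1) → S) (y : P),
        ε ^ m * ∑ σ' ∈ Bs.filter (fun σ' : Fin (m + 1) → S => ∀ e ∈ E, σ' e = τ' e),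
          ∑ x' ∈ univ.filter (fun x' : Fin (m + 1) → P => x' p = y), (wc x' * ‖W σ' x'‖) ≤ N) →
      ∑ σ' ∈ Bs.filter (fun σ' => compat σ'), ∑ x' : Fin (m + 1) → P,
          (wc x' * ‖W σ' x'‖) * (ε ^ m * a p x (τ'' p) (x' p) (σ' p)) ≤ ρc ^ E.card * c₁r * N := by
    intro Bs N hN0 hN
    -- fiberwise over the pinned position
    have hfib : ∀ σ' : Fin (m + 1) → S,
        ∑ x' : Fin (m + 1) → P, (wc x' * ‖W σ' x'‖) * (ε ^ m * a p x (τ'' p) (x' p) (σ' p)) =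
          ∑ y : P, a p x (τ'' p) y (σ' p) * f σ' y := by
      intro σ'
      rw [← Finset.sum_fiberwise univ (fun x' : Fin (m + 1) → P => x' p) _]
      refine sum_congr rfl fun y _ => ?_
      simp only [hf]
      rw [mul_sum, mul_sum]
      exact sum_congr rfl fun x' hx' => by rw [(mem_filter.1 hx').2]; ring
    rw [sum_congr rfl fun σ' _ => hfib σ']
    refine sum_prescribed_fibre_le E p hp τ'' child (fun y s' => a p x (τ'' p) y s') (fun y s' => ha0 p x _ y s')
      hc₁r hN0 (fun s' => h1r x (τ'' p) s') hρ Bs f hf0 fun τ' y => ?_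
    simpa only [hf, ← mul_sum] using hN τ' y
  -- the split of the count, pointwise
  have hsplit : ∀ (σ' : Fin (m + 1) → S) (x' : Fin (m + 1) → P),
      (wc x' * ‖W σ' x'‖) * (ε ^ m * (a p x (τ'' p) (x' p) (σ' p) *
        (c₁ ^ m * (if compat σ' then (if σ' ∈ B then R₂ else R₁) else 0)))) ≤
        (if compat σ' then c₁ ^ m * R₁ * ((wc x' * ‖W σ' x'‖) * (ε ^ m * a p x (τ'' p) (x' p) (σ' p))) else 0) +
          (if compat σ' ∧ σ' ∈ B then c₁ ^ m * R₂ * ((wc x' * ‖W σ' x'‖) * (ε ^ m * a p x (τ'' p) (x' p) (σ' p))) else 0) := by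
    intro σ' x'
    have hq : 0 ≤ (wc x' * ‖W σ' x'‖) * (ε ^ m * a p x (τ'' p) (x' p) (σ' p)) :=
      mul_nonneg (mul_nonneg (hwc0 x') (norm_nonneg _)) (mul_nonneg (pow_nonneg hε _) (ha0 p x _ (x' p) (σ' p)))
    have hc : 0 ≤ c₁ ^ m := pow_nonneg hc₁ _
    by_cases hco : compat σ'
    · by_cases hB : σ' ∈ B
      · have h0 : 0 ≤ c₁ ^ m * R₁ * ((wc x' * ‖W σ' x'‖) * (ε ^ m * a p x (τ'' p) (x' p) (σ' p))) :=
          mul_nonneg (mul_nonneg hc hR₁) hq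
        simp only [hco, hB, if_true, and_self]
        calc (wc x' * ‖W σ' x'‖) * (ε ^ m * (a p x (τ'' p) (x' p) (σ' p) * (c₁ ^ m * R₂)))
            = c₁ ^ m * R₂ * ((wc x' * ‖W σ' x'‖) * (ε ^ m * a p x (τ'' p) (x' p) (σ' p))) := by ring
          _ ≤ _ := le_add_of_nonneg_left h0
      · have h0 : 0 ≤ c₁ ^ m * R₂ * ((wc x' * ‖W σ' x'‖) * (ε ^ m * a p x (τ'' p) (x' p) (σ' p))) :=
          mul_nonneg (mul_nonneg hc hR₂) hq
        simp only [hco, hB, if_true, if_false, and_false, add_zero]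
        exact le_of_eq (by ring)
    · simp only [hco, if_false, false_and, mul_zero, add_zero]
      exact le_refl _
  -- the two coarse sums
  have hsumU : ∑ σ' : Fin (m + 1) → S, ∑ x' : Fin (m + 1) → P,
      (if compat σ' then c₁ ^ m * R₁ * ((wc x' * ‖W σ' x'‖) * (ε ^ m * a p x (τ'' p) (x' p) (σ' p))) else 0) ≤
        c₁ ^ m * R₁ * (ρc ^ E.card * c₁r * N₁) := by
    have hre : ∑ σ' : Fin (m + 1) → S, ∑ x' : Fin (m + 1) → P,
        (if compat σ' then c₁ ^ m * R₁ * ((wc x' * ‖W σ' x'‖) * (ε ^ m * a p x (τ'' p) (x' p) (σ' p))) else 0) =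
        c₁ ^ m * R₁ * ∑ σ' ∈ univ.filter (fun σ' => compat σ'), ∑ x' : Fin (m + 1) → P,
          (wc x' * ‖W σ' x'‖) * (ε ^ m * a p x (τ'' p) (x' p) (σ' p)) := by
      calc ∑ σ' : Fin (m + 1) → S, ∑ x' : Fin (m + 1) → P,
            (if compat σ' then c₁ ^ m * R₁ * ((wc x' * ‖W σ' x'‖) * (ε ^ m * a p x (τ'' p) (x' p) (σ' p))) else 0)
          = ∑ σ' : Fin (m + 1) → S, (if compat σ' then ∑ x' : Fin (m + 1) → P,
              c₁ ^ m * R₁ * ((wc x' * ‖W σ' x'‖) * (ε ^ m * a p x (τ'' p) (x' p) (σ' p))) else 0) :=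
            sum_congr rfl fun σ' _ => by split_ifs <;> simp
        _ = ∑ σ' ∈ univ.filter (fun σ' => compat σ'), ∑ x' : Fin (m + 1) → P,
              c₁ ^ m * R₁ * ((wc x' * ‖W σ' x'‖) * (ε ^ m * a p x (τ'' p) (x' p) (σ' p))) := by
            rw [← sum_filter]
        _ = _ := by rw [mul_sum]; exact sum_congr rfl fun σ' _ => by rw [mul_sum]
    rw [hre]
    exact mul_le_mul_of_nonneg_left (step4 univ N₁ hN₁0 hN₁) (mul_nonneg (pow_nonneg hc₁ _) hR₁)
  have hsumB : ∑ σ' : Fin (m + 1) → S, ∑ x' : Fin (m + 1) → P,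
      (if compat σ' ∧ σ' ∈ B then c₁ ^ m * R₂ * ((wc x' * ‖W σ' x'‖) * (ε ^ m * a p x (τ'' p) (x' p) (σ' p))) else 0) ≤
        c₁ ^ m * R₂ * (ρc ^ E.card * c₁r * N₂) := by
    have hre : ∑ σ' : Fin (m + 1) → S, ∑ x' : Fin (m + 1) → P,
        (if compat σ' ∧ σ' ∈ B then c₁ ^ m * R₂ * ((wc x' * ‖W σ' x'‖) * (ε ^ m * a p x (τ'' p) (x' p) (σ' p))) else 0) =
        c₁ ^ m * R₂ * ∑ σ' ∈ B.filter (fun σ' => compat σ'), ∑ x' : Fin (m + 1) → P,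
          (wc x' * ‖W σ' x'‖) * (ε ^ m * a p x (τ'' p) (x' p) (σ' p)) := by
      calc ∑ σ' : Fin (m + 1) → S, ∑ x' : Fin (m + 1) → P,
            (if compat σ' ∧ σ' ∈ B then c₁ ^ m * R₂ * ((wc x' * ‖W σ' x'‖) * (ε ^ m * a p x (τ'' p) (x' p) (σ' p))) else 0)
          = ∑ σ' : Fin (m + 1) → S, (if compat σ' ∧ σ' ∈ B then ∑ x' : Fin (m + 1) → P,
              c₁ ^ m * R₂ * ((wc x' * ‖W σ' x'‖) * (ε ^ m * a p x (τ'' p) (x' p) (σ' p))) else 0) :=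
            sum_congr rfl fun σ' _ => by split_ifs <;> simp
        _ = ∑ σ' ∈ B.filter (fun σ' => compat σ'), ∑ x' : Fin (m + 1) → P,
              c₁ ^ m * R₂ * ((wc x' * ‖W σ' x'‖) * (ε ^ m * a p x (τ'' p) (x' p) (σ' p))) := by
            rw [← sum_filter]
            congr 1
            ext σ'
            simp only [mem_filter, mem_univ, true_and]
            exact and_comm
        _ = _ := by rw [mul_sum]; exact sum_congr rfl fun σ' _ => by rw [mul_sum]
    rw [hre]
    exact mul_le_mul_of_nonneg_left (step4 B N₂ hN₂0 hN₂) (mul_nonneg (pow_nonneg hc₁ _) hR₂)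
  -- assemble
  calc ε ^ m * ∑ σ'' ∈ AE, ∑ x'' ∈ Xp,
        wf x'' * ‖∑ σ' : Fin (m + 1) → S, ∑ x' : Fin (m + 1) → P, (∏ i, T (x'' i, σ'' i) (x' i, σ' i)) * W σ' x'‖
      ≤ ∑ σ' : Fin (m + 1) → S, ∑ x' : Fin (m + 1) → P, (wc x' * ‖W σ' x'‖) *
          (ε ^ m * ∑ σ'' ∈ AE, ∑ x'' ∈ Xp, ∏ i, a i (x'' i) (σ'' i) (x' i) (σ' i)) := step1
    _ ≤ ∑ σ' : Fin (m + 1) → S, ∑ x' : Fin (m + 1) → P,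
          (wc x' * ‖W σ' x'‖) * (ε ^ m * (a p x (τ'' p) (x' p) (σ' p) *
            (c₁ ^ m * (if compat σ' then (if σ' ∈ B then R₂ else R₁) else 0)))) :=
        sum_le_sum fun σ' _ => sum_le_sum fun x' _ =>
          mul_le_mul_of_nonneg_left (mul_le_mul_of_nonneg_left (step3 σ' x') (pow_nonneg hε _))
            (mul_nonneg (hwc0 x') (norm_nonneg _))
    _ ≤ ∑ σ' : Fin (m + 1) → S, ∑ x' : Fin (m + 1) → P,
          ((if compat σ' then c₁ ^ m * R₁ * ((wc x' * ‖W σ' x'‖) * (ε ^ m * a p x (τ'' p) (x' p) (σ' p))) else 0) +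
            (if compat σ' ∧ σ' ∈ B then c₁ ^ m * R₂ * ((wc x' * ‖W σ' x'‖) * (ε ^ m * a p x (τ'' p) (x' p) (σ' p))) else 0)) :=
        sum_le_sum fun σ' _ => sum_le_sum fun x' _ => hsplit σ' x'
    _ = (∑ σ' : Fin (m + 1) → S, ∑ x' : Fin (m + 1) → P,
            (if compat σ' then c₁ ^ m * R₁ * ((wc x' * ‖W σ' x'‖) * (ε ^ m * a p x (τ'' p) (x' p) (σ' p))) else 0)) +
          ∑ σ' : Fin (m + 1) → S, ∑ x' : Fin (m + 1) → P,
            (if compat σ' ∧ σ' ∈ B then c₁ ^ m * R₂ * ((wc x' * ‖W σ' x'‖) * (ε ^ m * a p x (τ'' p) (x' p) (σ' p))) else 0) := by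
        rw [← sum_add_distrib]
        exact sum_congr rfl fun σ' _ => sum_add_distrib
    _ ≤ c₁ ^ m * R₁ * (ρc ^ E.card * c₁r * N₁) + c₁ ^ m * R₂ * (ρc ^ E.card * c₁r * N₂) := add_le_add hsumU hsumB
    _ = c₁ ^ m * c₁r * ρc ^ E.card * (R₁ * N₁ + R₂ * N₂) := by ring

end Literature.MathematicalPhysics.QuantumLattice

end
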